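import Summits.ResolutionOfSingularities.ResolutionOfSingularities.Theorems.EquisingularLiftEquisingularLiftNatMemberSAtStepRegular
import Summits.ResolutionOfSingularities.ResolutionOfSingularities.Theorems.EquisingularLiftEquisingularLiftNatLetterTransport
import Summits.ResolutionOfSingularities.ResolutionOfSingularities.Theorems.EquisingularLiftEquisingularLiftNatTowerPointPlaneModel
import HarnessLib

/-!
# [OURS · L1 W4.5(b) · EL♮(3) · T23-A‴ (U6)] THE REGULAR IN-CARRIER POINT STEP WITH LETTERS: `memberSL_strictTransform_of_regularPoint`
# (rule (D‴5′) of res-L1-w45b-stub-4's ENGINE WORD v1.1 f996922ad41a17f2; downstairs menu = res-L1-w45b-lead-2's `InCarrierReachKSs` 0c6a341d172f5c17: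
# `∀ P' ∈ Ps', P' = υ₁⁻¹{y} ∨ ∃ P ∈ Ps, y ∉ P ∧ P' = St P`)

res-type-027 g18 ((U6) owner), brick (F5a). OURS; NOT a statement of any manuscript ([Hironaka2017] is a candidate under adjudication, nothing of
it is asserted); AI-written, weaker than expert review. No `sorry`; standard axioms; DEF-FREE; `--supports stmt-ResolutionOfSingularities-20148 --as helper`.

WHAT. At a regular in-carrier point step `υ₁ : G₂ = Bl_y G → G` of a `TCPlus.MemberSL … G T Z Kd Sd Ls excl` (carrier plane `Sd` with its model
`𝓢`, letters `Ls` with `TCPlus.LetterDatum` models IN THE SAME STAGE, all closed):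
* the carrier plane, `𝓢`, `K` step by rule (b) = res-type-027's (A)S `memberSAt_strictTransform_of_regularPoint` (p627057; engine (A): res-L1-w45b-stub-4 /
  -stub-1) — SAME section `s`, SAME blow-up `τ : X₂ = Bl_{ker s} X → X`, SAME model square `(j₂, t₂)`;
* `TCPlus.letterDatum_newPlane`: the NEW plane `υ₁⁻¹{y}` is BORN WITH ITS MODEL `(ker s)·𝒪_{X₂}` in that stage ((F1); res-L1-w45b-stub-2's
  `exists_planeModel` p624223 over res-L1-w45b-lead-1's `pointPlane_model` p623734; `G` regular at `y` = the step's `hamb`);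
* every letter `L ∈ Ls` with `y ∉ L` keeps its model (rule (a): `TCPlus.letters_transport_away` p626721, the disjointness from the `{jG y}`-fibre fact of
  p627057 by `disjoint_support_of_inter_fibre_eq_singleton`); letters through `y` are dropped from the model list (rule (c′): they continue model-less
  downstairs in `Ms`, bookkeeping `TCPlus.letter_bookkeeping`).
Conclusion in MENU form: for every list `Ls'` drawn from `{υ₁⁻¹{y}} ∪ {St L | L ∈ Ls, y ∉ L}`, `TCPlus.MemberSL … G₂ (St T) (St Z) (St Kd) (St Sd) Ls' (υ₁⁻¹ excl)`
and every `L' ∈ Ls'` is closed.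
[cite: GortzWedhorn2020, Prop. 13.91 and (13.19)] [cite: Liu2002, Thm. 8.1.19] [cite: Matsumura1987, Thm. 14.2] [cite: StacksProject, Tag 01WS]
-/

set_option linter.dupNamespace false -- mandated namespace `Summit.<Summit>.<Problem>` of this single-conjunct summit
set_option linter.overlappingInstances false -- signatures carry `[IsDomain O] [IsDiscreteValuationRing O]`

noncomputable section

open CategoryTheory CategoryTheory.Limits AlgebraicGeometry TopologicalSpace Topology IsLocalRing
open Literature.AlgebraicGeometry.Resolution
open AlgebraicGeometry.Scheme.IdealSheafData
open Summit.ResolutionOfSingularities.ResolutionOfSingularities.Theses.EquisingularLift.Split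
open Summit.ResolutionOfSingularities.ResolutionOfSingularities.Cruxes.EquisingularLift.StrataSplit

namespace Summit.ResolutionOfSingularities.ResolutionOfSingularities.Cruxes.EquisingularLiftNat.Sections

/-! ## (F1) at an in-carrier step: the new plane is born with its model -/

/-- **The new plane's letter.** At a section step (`s` a section of `σ ≫ q` through `jG y`, `τ = Bl_{ker s}`, `υ₁ = Bl_y`, `j₂ ≫ τ = υ₁ ≫ jG`) with `G`
regular at the closed point `y`, the new plane `υ₁⁻¹{y}` carries the model `(ker s)·𝒪_{X₂}`: `TCPlus.LetterDatum … G₂ X₂ (τ ≫ σ) j₂ (υ₁⁻¹{y})`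
(res-L1-w45b-stub-2's `exists_planeModel`; the section facts as in `modelPointStep_of_section`). [cite: Liu2002, Thm. 8.1.19 (b)]
[cite: GortzWedhorn2020, Prop. 13.91] [OURS · L1 W4.5b · T23-A‴ (U6)/(F1)]; NOT a statement of the manuscript. -/
theorem TCPlus.letterDatum_newPlane (O : Type) [CommRing O] [IsDomain O] [IsDiscreteValuationRing O] {k : Type} [Field k] {θ : O →+* k}
    (hθ : Function.Surjective θ) (P : Scheme.{0}) (q : P ⟶ Spec (.of O)) (Y : Set P) (hY : Y ⊆ q ⁻¹' {closedPoint O})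
    {X X₂ G G₂ : Scheme.{0}} [IsIntegral G] [IsLocallyNoetherian X] (hXreg : Scheme.IsRegular X) {σ : X ⟶ P} [IsSeparated (σ ≫ q)]
    {jG : G ⟶ X} {tG : G ⟶ Spec (.of k)} (hsq : IsPullback jG tG (σ ≫ q) (Spec.map (CommRingCat.ofHom θ)))
    {s : Spec (.of O) ⟶ X} (hs : s ≫ σ ≫ q = 𝟙 _) {y : G} (hy : IsClosed ({y} : Set G)) (hss₀ : s (closedPoint O) = jG y)
    (hw : ¬ IsGenericPoint (σ (jG y)) Y) (hGreg : IsRegularLocalRing (G.presheaf.stalk y))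
    {τ : X₂ ⟶ X} (hτ : IsBlowup τ s.ker) {υ₁ : G₂ ⟶ G} (hυ₁ : IsBlowup υ₁ (vanishingIdeal ⟨{y}, hy⟩))
    {j₂ : G₂ ⟶ X₂} (hcomm : j₂ ≫ τ = υ₁ ≫ jG) :
    TCPlus.LetterDatum O P q Y G₂ X₂ (τ ≫ σ) j₂ (υ₁ ⁻¹' {y}) := by
  haveI : IsClosedImmersion (Spec.map (CommRingCat.ofHom θ)) := IsClosedImmersion.spec_of_surjective _ hθ
  haveI hjci : IsClosedImmersion jG := MorphismProperty.IsStableUnderBaseChange.of_isPullback hsq.flip inferInstance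
  haveI : IsLocallyNoetherian G := LocallyOfFiniteType.isLocallyNoetherian jG
  have hrangej : Set.range jG = (σ ≫ q) ⁻¹' {closedPoint O} := by
    rw [range_eq_preimage_of_isPullback hsq, range_specMap_of_surjective_of_field θ hθ]
  have hrange' : Set.range (jG ≫ σ ≫ q) ⊆ {closedPoint O} := by
    rintro _ ⟨y', rfl⟩
    have h1 : jG y' ∈ Set.range jG := ⟨y', rfl⟩
    rw [hrangej] at h1
    exact h1
  obtain ⟨_, hsreg, -, hCsupp⟩ := section_isClosedImmersion_and_isRegular_ker O X (σ ≫ q) s hs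
  have hsflat : Flat (s.ker.subschemeι ≫ σ ≫ q) := flat_kerSubschemeι_comp_of_section O (σ ≫ q) s hs
  have hCD : s.ker.comap jG = vanishingIdeal ⟨{y}, hy⟩ :=
    ker_section_comap_eq_vanishingIdeal O X G (σ ≫ q) s hs jG hrange' y hss₀.symm hy
  have hrs : ∀ p : Spec (.of O), (σ ≫ q) (s p) = p := fun p => by
    rw [← Scheme.Hom.comp_apply, hs]; rfl
  have hsoff : ∀ c ∈ (s.ker.support : Set X), ¬ IsGenericPoint (σ c) Y := by
    intro c hc hgen
    rw [hCsupp] at hc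
    obtain ⟨p, rfl⟩ := hc
    have hps : p = closedPoint O := by
      rw [← hrs p]
      show (σ ≫ q) (s p) = closedPoint O
      rw [Scheme.Hom.comp_apply]
      exact hY hgen.mem
    rw [hps, hss₀] at hgen
    exact hw hgen
  obtain ⟨𝓔, rfl, h1, h2, h3, h4, h5, -⟩ := exists_planeModel (Y := Y) hXreg hsreg hsflat hsoff hτ hy hGreg hυ₁ hcomm hCD
  have hE : IsClosed (υ₁ ⁻¹' ({y} : Set G)) := hy.preimage υ₁.continuous
  have hcl : (⟨closure (υ₁ ⁻¹' ({y} : Set G)), isClosed_closure⟩ : Closeds G₂) = ⟨υ₁ ⁻¹' {y}, hE⟩ := Closeds.ext hE.closure_eq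
  refine ⟨s.ker.comap τ, ?_, h2, h3, h4, h5⟩
  rw [hcl]
  exact h1 hE

/-! ## The regular in-carrier point step with letters (menu form) -/

/-- **(A)SL — the regular in-carrier point step at `TCPlus.MemberSL`** (see the module docstring): carrier plane by rule (b) (p627057), new plane born
with model, away letters keep their models (rule (a), p626721), letters through the point dropped (rule (c′)). [cite: Matsumura1987, Thm. 14.2 and Thm. 20.3]
[cite: GortzWedhorn2020, Prop. 13.91 and Prop. 13.96] [cite: Liu2002, Thm. 8.1.19] [cite: StacksProject, Tag 01WS] [OURS · L1 W4.5b · T23-A‴ (U6)] brick (F5a)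
(stmt-ResolutionOfSingularities-20148); NOT a statement of the manuscript. -/
theorem memberSL_strictTransform_of_regularPoint (O : Type) [CommRing O] [IsDomain O] [IsDiscreteValuationRing O]
    [IsAdicComplete (maximalIdeal O) O] [IsAlgClosed (ResidueField O)] (k : Type) [Field k] (θ : O →+* k)
    (hθ : Function.Surjective θ)
    (P : Scheme.{0}) (q : P ⟶ Spec (.of O)) (Y : Set P) (hY : Y ⊆ q ⁻¹' {closedPoint O}) (hYirr : IsIrreducible Y)
    (hYcl : IsClosed Y) [IsProper q] [IsIntegral P] (hPnoeth : IsLocallyNoetherian P) (hPreg : Scheme.IsRegular P)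
    [SmoothOfRelativeDimension 3 q]
    (Ch : ∀ X' : Scheme.{0}, (X' ⟶ P) → Set X' → Prop)
    (hChain : ∀ (X' : Scheme.{0}) (σ : X' ⟶ P) (S : Set X'), Ch X' σ S → Chain P Y X' σ S)
    (hStep : ∀ (X' X'' : Scheme.{0}) (σ' : X' ⟶ P) (S' : Set X') (C : X'.IdealSheafData) (τ : X'' ⟶ X'),
      Ch X' σ' S' → IsBlowup τ C → Scheme.IsRegular C.subscheme → Flat (C.subschemeι ≫ σ' ≫ q) →
      σ' '' (C.support : Set X') ⊆ {x : P | ¬ IsGenericPoint x Y} →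
      (C.support : Set X') ∩ (σ' ≫ q) ⁻¹' {closedPoint O} ⊆ S' →
      Ch X'' (τ ≫ σ') (closure (τ ⁻¹' (S' \ (C.support : Set X')))))
    -- the package transport (res-D-pv-029's T-PKG-TRANSPORT-SCHEME), used only at the excluded points
    (hpkg : ∀ ⦃X X₂ : Scheme.{0}⦄ [IsIntegral X] [IsLocallyNoetherian X] [IsLocallyNoetherian X₂] (σ : X ⟶ P)
      [IsSeparated (σ ≫ q)], Scheme.IsRegular X → ∀ (s : Spec (.of O) ⟶ X), s ≫ σ ≫ q = 𝟙 _ → ∀ (τ : X₂ ⟶ X), IsBlowup τ s.ker →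
      ∀ (𝓢 K : X.IdealSheafData) (p' : X), p' ∉ (s.ker.support : Set X) → ∀ (p'₂ : X₂), τ p'₂ = p' →
      TCPlus.CentredPackage O P q X σ 𝓢 K p' →
      TCPlus.CentredPackage O P q X₂ (τ ≫ σ) (strictTransformIdeal τ s.ker 𝓢) (strictTransformIdeal τ s.ker K) p'₂)
    -- the member and the point
    (G : Scheme.{0}) [IsIntegral G] (T Z Kd Sd excl : Set G) (Ls : List (Set G))
    (hmem : TCPlus.MemberSL O k θ P q Y Ch G T Z Kd Sd Ls excl) (hLcl : ∀ L ∈ Ls, IsClosed L)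
    (hZcl : IsClosed Z)
    (hTirr : IsIrreducible T) (y : G) (hy : IsClosed ({y} : Set G)) (hyZ : y ∈ closure Z) (hyT : y ∈ T) (hTZ : ¬ T ⊆ closure Z)
    (hyexcl : y ∉ excl)
    (hyreg : IsRegularLocalRing (G.presheaf.stalk y ⧸ stalkIdeal (vanishingIdeal ⟨closure Z, isClosed_closure⟩) y))
    (hamb : IsRegularLocalRing (G.presheaf.stalk y))
    (G₂ : Scheme.{0}) (υ₁ : G₂ ⟶ G) (hυ₁ : IsBlowup υ₁ (vanishingIdeal ⟨{y}, hy⟩)) :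
    IsIntegral G₂ ∧ IsIrreducible (closure (υ₁ ⁻¹' (T \ {y}))) ∧
      ¬ closure (υ₁ ⁻¹' (T \ {y})) ⊆ closure (closure (υ₁ ⁻¹' (Z \ {y}))) ∧
      ∀ Ls' : List (Set G₂), (∀ L' ∈ Ls', L' = υ₁ ⁻¹' {y} ∨ ∃ L ∈ Ls, y ∉ L ∧ L' = closure (υ₁ ⁻¹' (L \ {y}))) →
        (∀ L' ∈ Ls', IsClosed L') ∧
        TCPlus.MemberSL O k θ P q Y Ch G₂ (closure (υ₁ ⁻¹' (T \ {y}))) (closure (υ₁ ⁻¹' (Z \ {y})))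
          (closure (υ₁ ⁻¹' (Kd \ {y}))) (closure (υ₁ ⁻¹' (Sd \ {y}))) Ls' (υ₁ ⁻¹' excl) := by
  classical
  obtain ⟨X, σ, S, jG, tG, 𝓢, K, hmemAt, hLs⟩ := hmem
  obtain ⟨s, X₂, τ, j₂, t₂, hs, hss₀, hτ, hcomm, hCb, hG₂int, hirr₂, hT₂Z₂, hmem₂⟩ :=
    memberSAt_strictTransform_of_regularPoint O k θ hθ P q Y hY hYirr hYcl hPnoeth hPreg Ch hChain hStep hpkg G T Z Kd Sd excl X σ S
      jG tG 𝓢 K hmemAt hZcl hTirr y hy hyZ hyT hTZ hyexcl hyreg hamb G₂ υ₁ hυ₁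
  obtain ⟨hCh, hXint, hXnoeth, hXreg, -, hsq, -, hi, -, -, -, hiv, -, -, -, -, -, -⟩ := hmemAt
  haveI := hXint
  haveI := hXnoeth
  -- the old stage: proper over `O`, `jG` a closed immersion, the point on `V(𝓢 ⊔ K)` hence off the generic point of `Y`
  obtain ⟨-, -, hσ⟩ := chain_isRegular P Y X σ S (hChain _ _ _ hCh) hPnoeth hPreg
  haveI := hσ
  haveI : IsProper (σ ≫ q) := inferInstance
  haveI : IsClosedImmersion (Spec.map (CommRingCat.ofHom θ)) := IsClosedImmersion.spec_of_surjective _ hθ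
  haveI hjci : IsClosedImmersion jG := MorphismProperty.IsStableUnderBaseChange.of_isPullback hsq.flip inferInstance
  haveI : IsLocallyNoetherian G := LocallyOfFiniteType.isLocallyNoetherian jG
  have hyC : jG y ∈ ((𝓢 ⊔ K).support : Set X) := by
    have h1 : y ∈ (((𝓢 ⊔ K).comap jG).support : Set G) := by
      rw [hi, Scheme.IdealSheafData.coe_support_vanishingIdeal]; exact hyZ
    rw [Scheme.IdealSheafData.support_comap] at h1
    exact h1
  have hw : ¬ IsGenericPoint (σ (jG y)) Y := hiv ⟨jG y, hyC, rfl⟩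
  -- (F1) the new plane with its model; (a) the away letters; the `{jG y}`-fibre disjointness
  have hnew : TCPlus.LetterDatum O P q Y G₂ X₂ (τ ≫ σ) j₂ (υ₁ ⁻¹' {y}) :=
    TCPlus.letterDatum_newPlane O hθ P q Y hY hXreg hsq hs hy hss₀ hw hamb hτ hυ₁ hcomm
  have hdisj : ∀ I : X.IdealSheafData, jG y ∉ (I.support : Set X) → Disjoint (I.support : Set X) (s.ker.support : Set X) :=
    fun I hI => disjoint_support_of_inter_fibre_eq_singleton (σ ≫ q) s.ker I hCb hI
  have hJ : (((vanishingIdeal ⟨{y}, hy⟩ : G.IdealSheafData)).support : Set G) = {y} :=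
    Scheme.IdealSheafData.coe_support_vanishingIdeal _
  have haway := TCPlus.letters_transport_away O P q Y hτ hυ₁ hJ hcomm hdisj (fun L hL => ⟨hLcl L hL, hLs L hL⟩)
  refine ⟨hG₂int, hirr₂, hT₂Z₂, fun Ls' hLs' => ⟨fun L' hL' => ?_, X₂, τ ≫ σ, _, j₂, t₂, _, _, hmem₂, fun L' hL' => ?_⟩⟩
  · rcases hLs' L' hL' with rfl | ⟨L, -, -, rfl⟩
    · exact hy.preimage υ₁.continuous
    · exact isClosed_closure
  · rcases hLs' L' hL' with rfl | ⟨L, hL, hyL, rfl⟩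
    · exact hnew
    · exact haway L hL hyL

end Summit.ResolutionOfSingularities.ResolutionOfSingularities.Cruxes.EquisingularLiftNat.Sections

end
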